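import Literature.MathematicalPhysics.QuantumLattice.GibbsStationaritySlack
import Literature.Computation.Certificates.SemidefiniteComplementarity
import HarnessLib

/-!
# Second-order KKT rows are EXACT for lowering modes: Bogoliubov annihilators kill every feasible state

Topic `MathematicalPhysics/QuantumLattice` (family `hubbard`; cell `hubbard-cq`, card
`sourced-kkt-one-point-floor`, calibration theorem «kkt-u0-bogoliubov-exactness»). Companion of
`GibbsStationaritySlack.lean` §GroundStateMixed (the SOUNDNESS half: every ground-supported density matrix
`ρ` satisfies the second-order stationarity row `0 ≤ Tr(ρ Aᴴ(HA − AH))` for every `A`,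
`trace_mul_conjTranspose_comm_mul_nonneg`, after Araújo–Klep–Garner–Vértesi–Navascués, Prop. 11).

This file proves the converse direction for LOWERING MODES, an abstract matrix statement with no lattice:
if `[H, γ] = -E·γ` with `E > 0` (a Bogoliubov / ladder annihilator of `H`: `Hγ = γ(H - E)`), then for
ANY `ρ ⪰ 0` the single row `0 ≤ Re Tr(ρ γᴴ[H, γ])` already forces `Tr(ρ γᴴγ) = 0`
(`trace_mul_conjTranspose_mul_self_eq_zero_of_row`: the row reads `-E · Tr(ρ γᴴγ) ≥ 0` against
`Tr(ρ γᴴγ) = Tr(γργᴴ) ≥ 0`), hence `γρ = 0 = ργᴴ` (`mul_eq_zero_of_trace_mul_conjTranspose_mul_self_eq_zero`,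
complementary slackness). Consequences for a finite family `γ_k` of such modes
(`annihilate_of_rows`, and `annihilate_of_groundState` for genuine ground states):

* every quadratic word is FIXED: `Tr(ρ γ_lᴴγ_k) = 0`, `Tr(ρ γ_kγ_l) = 0`, `Tr(ρ γ_kᴴγ_lᴴ) = 0`, and
  `Tr(ρ γ_kγ_lᴴ) = Tr(ρ {γ_k, γ_lᴴ})` (`trace_words_of_annihilate`); with canonical anticommutators
  `{γ_k, γ_lᴴ} = δ_{kl}` (CAR data, a hypothesis) `Tr(ρ γ_kγ_lᴴ) = δ_{kl} Tr ρ` (`trace_mul_mul_conjTranspose_of_car`);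
* EXACTNESS: two states `ρ₁, ρ₂ ⪰ 0` of equal trace, both feasible for the rows (or both annihilated), agree
  on every quadratic word and on every product `AB` of two elements of the linear span of the `γ_k, γ_kᴴ`
  (`trace_mul_mul_eq_of_annihilate`, `trace_oneBody_mul_oneBody_eq_of_annihilate`) whenever the
  anticommutators `{γ_k, γ_lᴴ}` are scalars — so a relaxation whose rows include the second-order
  stationarity rows of the Bogoliubov annihilators of a QUADRATIC fermion Hamiltonian (e.g. the `U = 0`
  d-wave-sourced torus) pins every one-body word `Tr(ρ c_i†c_j)`, `Tr(ρ c_ic_j)` to its quasi-free ground-state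
  value: the certified one-point floor is EXACT at `U = 0` (dual-2's claim; census (9) scope). The Bogoliubov
  transformation itself (the `γ_k`, `E_k` and the CAR data for the model at hand) is INPUT here.

No definition and no named fact is introduced.

## References
* M. Araújo, I. Klep, A. J. P. Garner, T. Vértesi, M. Navascués, *First-order optimality conditions for
  non-commutative optimization problems*, arXiv:2311.18707 (2023), §3.2 Prop. 11 [AraujoEtAl2023] (state
  optimality / KKT rows `ω(Aᴴ[H,A]) ≥ 0`).
* V. Bach, E. H. Lieb, J. P. Solovej, J. Stat. Phys. 76 (1994) 3–89 [BachLiebSolovej1994], §2 (quasi-free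
  states; ground states of quadratic Hamiltonians are quasi-free and fixed by their one-body words).
* G. Blekherman, P. A. Parrilo, R. R. Thomas (eds.), *Semidefinite Optimization and Convex Algebraic
  Geometry* (2012), App. A Cor. A.24 [BlekhermanParriloThomas2012] (`Tr(XZ) = 0 ⇔ XZ = 0` for `X, Z ⪰ 0`).
-/

noncomputable section

open Matrix Finset
open scoped ComplexOrder

namespace Literature.MathematicalPhysics.QuantumLattice

variable {n : Type*} [Fintype n] [DecidableEq n]

/-! ### One lowering mode -/

section OneMode

variable {H γ ρ : Matrix n n ℂ} {E : ℝ}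

omit [DecidableEq n] in
/-- The second-order row of a lowering mode: `[H, γ] = -Eγ` gives `Tr(ρ γᴴ(Hγ − γH)) = -E · Tr(ρ γᴴγ)`.
[cite: AraujoEtAl2023, §3.2 Prop. 11] -/
theorem trace_mul_conjTranspose_comm_mul_of_lowering (hγ : H * γ - γ * H = -((E : ℂ) • γ)) :
    (ρ * (γᴴ * (H * γ - γ * H))).trace = -(E : ℂ) * (ρ * (γᴴ * γ)).trace := by
  rw [hγ, Matrix.mul_neg, Matrix.mul_smul, Matrix.mul_neg, Matrix.mul_smul, Matrix.trace_neg,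
    Matrix.trace_smul, smul_eq_mul, neg_mul]

omit [DecidableEq n] in
/-- **Exactness of the second-order row for a lowering mode.** If `ρ ⪰ 0`, `[H, γ] = -Eγ` with `E > 0`,
and the single KKT row `0 ≤ Re Tr(ρ γᴴ(Hγ − γH))` holds, then `Tr(ρ γᴴγ) = 0`: the row says
`-E · Re Tr(ρ γᴴγ) ≥ 0` while `Tr(ρ γᴴγ) = Tr(γργᴴ) ≥ 0`. [cite: AraujoEtAl2023, §3.2 Prop. 11]
[cite: BachLiebSolovej1994, §2] -/
theorem trace_mul_conjTranspose_mul_self_eq_zero_of_row (hρ : ρ.PosSemidef)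
    (hγ : H * γ - γ * H = -((E : ℂ) • γ)) (hE : 0 < E)
    (hrow : 0 ≤ (ρ * (γᴴ * (H * γ - γ * H))).trace.re) : (ρ * (γᴴ * γ)).trace = 0 := by
  have hcyc : (ρ * (γᴴ * γ)).trace = (γ * ρ * γᴴ).trace := by
    rw [← Matrix.mul_assoc, Matrix.trace_mul_cycle]
  have hnn := Complex.nonneg_iff.1 (hρ.mul_mul_conjTranspose_same γ).trace_nonneg
  rw [← hcyc] at hnn
  rw [trace_mul_conjTranspose_comm_mul_of_lowering hγ] at hrow
  have hre : (-(E : ℂ) * (ρ * (γᴴ * γ)).trace).re = -E * (ρ * (γᴴ * γ)).trace.re := by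
    simp [Complex.mul_re]
  rw [hre] at hrow
  have h0 : (ρ * (γᴴ * γ)).trace.re = 0 := by nlinarith [hnn.1, hrow, hE]
  exact Complex.ext (by simpa using h0) (by simpa using hnn.2.symm)

/-- **Annihilation.** For `ρ ⪰ 0`, `Tr(ρ γᴴγ) = 0` forces `γρ = 0` and `ργᴴ = 0` (complementary
slackness `Tr(XZ) = 0 ⇒ XZ = 0` for `X = ρ`, `Z = γᴴγ`, then `(ργᴴ)(ργᴴ)ᴴ = ρ(γᴴγ)ρ = 0`).
[cite: BlekhermanParriloThomas2012, App. A Cor. A.24] -/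
theorem mul_eq_zero_of_trace_mul_conjTranspose_mul_self_eq_zero (hρ : ρ.PosSemidef)
    (h : (ρ * (γᴴ * γ)).trace = 0) : γ * ρ = 0 ∧ ρ * γᴴ = 0 := by
  have h1 : ρ * (γᴴ * γ) = 0 :=
    (Literature.Computation.Certificates.SemidefiniteComplementarity.trace_mul_eq_zero_iff hρ
      (posSemidef_conjTranspose_mul_self γ)).1 h
  have h2 : ρ * γᴴ = 0 := by
    rw [← Matrix.self_mul_conjTranspose_eq_zero]
    calc ρ * γᴴ * (ρ * γᴴ)ᴴ = ρ * (γᴴ * γ) * ρ := by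
          rw [Matrix.conjTranspose_mul, Matrix.conjTranspose_conjTranspose, hρ.isHermitian.eq]
          simp only [Matrix.mul_assoc]
      _ = 0 := by rw [h1, Matrix.zero_mul]
  refine ⟨?_, h2⟩
  have h3 := congrArg Matrix.conjTranspose h2
  rwa [Matrix.conjTranspose_mul, Matrix.conjTranspose_conjTranspose, hρ.isHermitian.eq,
    Matrix.conjTranspose_zero] at h3

end OneMode

/-! ### A family of lowering modes: annihilation from the rows, and from ground states -/

section Family

variable {K : Type*} {H ρ : Matrix n n ℂ} (γ : K → Matrix n n ℂ) (E : K → ℝ)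

/-- **KKT rows ⇒ annihilation.** If `ρ ⪰ 0`, every `γ_k` is a lowering mode (`[H, γ_k] = -E_kγ_k`, `E_k > 0`)
and the second-order rows `0 ≤ Re Tr(ρ γ_kᴴ(Hγ_k − γ_kH))` hold, then `γ_kρ = 0 = ργ_kᴴ` for every `k`.
This uses NO energy datum and no other row. [cite: AraujoEtAl2023, §3.2 Prop. 11] [cite: BachLiebSolovej1994, §2] -/
theorem annihilate_of_rows (hρ : ρ.PosSemidef) (hγ : ∀ k, H * γ k - γ k * H = -((E k : ℂ) • γ k))
    (hE : ∀ k, 0 < E k) (hrow : ∀ k, 0 ≤ (ρ * ((γ k)ᴴ * (H * γ k - γ k * H))).trace.re) (k : K) :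
    γ k * ρ = 0 ∧ ρ * (γ k)ᴴ = 0 :=
  mul_eq_zero_of_trace_mul_conjTranspose_mul_self_eq_zero hρ
    (trace_mul_conjTranspose_mul_self_eq_zero_of_row hρ (hγ k) (hE k) (hrow k))

/-- **Ground states are annihilated** (soundness composed with exactness): for Hermitian `H` and a
ground-supported `ρ ⪰ 0` (`Hρ = E₀ρ`), every lowering mode with `E_k > 0` satisfies `γ_kρ = 0 = ργ_kᴴ` — the
rows hold in every ground state by `trace_mul_conjTranspose_comm_mul_nonneg`.
[cite: BachLiebSolovej1994, §2] [cite: AraujoEtAl2023, §3.2 Prop. 11] -/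
theorem annihilate_of_groundState (hH : H.IsHermitian) (hρ : ρ.PosSemidef)
    (hHρ : H * ρ = (H.groundEnergy : ℂ) • ρ) (hγ : ∀ k, H * γ k - γ k * H = -((E k : ℂ) • γ k))
    (hE : ∀ k, 0 < E k) (k : K) : γ k * ρ = 0 ∧ ρ * (γ k)ᴴ = 0 :=
  annihilate_of_rows γ E hρ hγ hE
    (fun k => (Complex.nonneg_iff.1 (trace_mul_conjTranspose_comm_mul_nonneg hH hρ hHρ (γ k))).1) k

/-! ### Quadratic words in an annihilated state -/

variable {γ}

omit [DecidableEq n] in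
/-- **The quadratic words of an annihilated state.** If `γ_kρ = 0 = ργ_kᴴ` for all `k`, then for all `k, l`:
`Tr(ρ γ_lᴴγ_k) = 0`, `Tr(ρ γ_kγ_l) = 0`, `Tr(ρ γ_kᴴγ_lᴴ) = 0`, and `Tr(ρ γ_kγ_lᴴ) = Tr(ρ(γ_kγ_lᴴ + γ_lᴴγ_k))`
(only the anticommutator survives). [cite: BachLiebSolovej1994, §2] -/
theorem trace_words_of_annihilate (hann : ∀ k, γ k * ρ = 0 ∧ ρ * (γ k)ᴴ = 0) (k l : K) :
    (ρ * ((γ l)ᴴ * γ k)).trace = 0 ∧ (ρ * (γ k * γ l)).trace = 0 ∧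
      (ρ * ((γ k)ᴴ * (γ l)ᴴ)).trace = 0 ∧
        (ρ * (γ k * (γ l)ᴴ)).trace = (ρ * (γ k * (γ l)ᴴ + (γ l)ᴴ * γ k)).trace := by
  have h1 : (ρ * ((γ l)ᴴ * γ k)).trace = 0 := by
    rw [← Matrix.mul_assoc, Matrix.trace_mul_cycle, (hann k).1, Matrix.zero_mul, Matrix.trace_zero]
  refine ⟨h1, ?_, ?_, ?_⟩
  · rw [← Matrix.mul_assoc, Matrix.trace_mul_cycle, (hann l).1, Matrix.zero_mul, Matrix.trace_zero]
  · rw [← Matrix.mul_assoc, (hann k).2, Matrix.zero_mul, Matrix.trace_zero]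
  · rw [Matrix.mul_add, Matrix.trace_add, h1, add_zero]

/-- **With canonical anticommutators** `{γ_k, γ_lᴴ} = δ_{kl}` (CAR data, a hypothesis on the family):
`Tr(ρ γ_kγ_lᴴ) = δ_{kl} Tr ρ` in every annihilated state. [cite: BachLiebSolovej1994, §2] -/
theorem trace_mul_mul_conjTranspose_of_car [DecidableEq K] (hann : ∀ k, γ k * ρ = 0 ∧ ρ * (γ k)ᴴ = 0)
    (hcar : ∀ k l, γ k * (γ l)ᴴ + (γ l)ᴴ * γ k = if k = l then 1 else 0) (k l : K) :
    (ρ * (γ k * (γ l)ᴴ)).trace = if k = l then ρ.trace else 0 := by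
  rw [(trace_words_of_annihilate hann k l).2.2.2, hcar]
  split_ifs <;> simp

/-- **Exactness on quadratic words**: two annihilated states with the same trace agree on `Tr(· γ_kγ_lᴴ)`
whenever the anticommutator `{γ_k, γ_lᴴ}` is a scalar (the other three quadratic words vanish in both by
`trace_words_of_annihilate`). [cite: BachLiebSolovej1994, §2] -/
theorem trace_mul_mul_eq_of_annihilate {ρ₁ ρ₂ : Matrix n n ℂ}
    (h₁ : ∀ k, γ k * ρ₁ = 0 ∧ ρ₁ * (γ k)ᴴ = 0) (h₂ : ∀ k, γ k * ρ₂ = 0 ∧ ρ₂ * (γ k)ᴴ = 0)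
    (hanti : ∀ k l, ∃ c : ℂ, γ k * (γ l)ᴴ + (γ l)ᴴ * γ k = c • (1 : Matrix n n ℂ))
    (htr : ρ₁.trace = ρ₂.trace) (k l : K) :
    (ρ₁ * (γ k * (γ l)ᴴ)).trace = (ρ₂ * (γ k * (γ l)ᴴ)).trace := by
  obtain ⟨c, hc⟩ := hanti k l
  rw [(trace_words_of_annihilate h₁ k l).2.2.2, (trace_words_of_annihilate h₂ k l).2.2.2, hc,
    Matrix.mul_smul, Matrix.mul_one, Matrix.trace_smul, Matrix.mul_smul, Matrix.mul_one,
    Matrix.trace_smul, htr]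

omit [DecidableEq n] in
/-- Expansion of `Tr(ρ·AB)` for `A = Σ_k (a_k γ_k + b_k γ_kᴴ)`, `B = Σ_l (a'_l γ_l + b'_l γ_lᴴ)` into the four
families of quadratic words. [folklore] -/
private theorem trace_mul_oneBody_mul_oneBody_expand [Fintype K] (ρ : Matrix n n ℂ) (a b a' b' : K → ℂ) :
    (ρ * ((∑ k, (a k • γ k + b k • (γ k)ᴴ)) * (∑ l, (a' l • γ l + b' l • (γ l)ᴴ)))).trace =
      ∑ k, ∑ l, (a k * a' l * (ρ * (γ k * γ l)).trace + a k * b' l * (ρ * (γ k * (γ l)ᴴ)).trace +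
        b k * a' l * (ρ * ((γ k)ᴴ * γ l)).trace + b k * b' l * (ρ * ((γ k)ᴴ * (γ l)ᴴ)).trace) := by
  rw [Finset.sum_mul_sum, Finset.mul_sum, Matrix.trace_sum]
  refine Finset.sum_congr rfl fun k _ => ?_
  rw [Finset.mul_sum, Matrix.trace_sum]
  refine Finset.sum_congr rfl fun l _ => ?_
  simp only [Matrix.add_mul, Matrix.mul_add, Matrix.smul_mul, Matrix.mul_smul, Matrix.trace_add,
    Matrix.trace_smul, smul_eq_mul]
  ring

/-- **Exactness on products of one-body operators.** Let `A = Σ_k (a_k γ_k + b_k γ_kᴴ)` and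
`B = Σ_l (a'_l γ_l + b'_l γ_lᴴ)` be two elements of the linear span of the modes and their adjoints (for a
quadratic fermion Hamiltonian: any two one-body operators `c_i, c_i†`, by the inverse Bogoliubov
transformation, an INPUT here). Two annihilated states of equal trace agree on `Tr(· AB)` when the
anticommutators `{γ_k, γ_lᴴ}` are scalars: the KKT-feasible set is a POINT on one-body words, so a certified
one-point bound from these rows is the exact quasi-free value. [cite: BachLiebSolovej1994, §2]
[cite: AraujoEtAl2023, §3.2 Prop. 11] -/
theorem trace_oneBody_mul_oneBody_eq_of_annihilate [Fintype K] {ρ₁ ρ₂ : Matrix n n ℂ}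
    (h₁ : ∀ k, γ k * ρ₁ = 0 ∧ ρ₁ * (γ k)ᴴ = 0) (h₂ : ∀ k, γ k * ρ₂ = 0 ∧ ρ₂ * (γ k)ᴴ = 0)
    (hanti : ∀ k l, ∃ c : ℂ, γ k * (γ l)ᴴ + (γ l)ᴴ * γ k = c • (1 : Matrix n n ℂ))
    (htr : ρ₁.trace = ρ₂.trace) (a b a' b' : K → ℂ) :
    (ρ₁ * ((∑ k, (a k • γ k + b k • (γ k)ᴴ)) * (∑ l, (a' l • γ l + b' l • (γ l)ᴴ)))).trace =
      (ρ₂ * ((∑ k, (a k • γ k + b k • (γ k)ᴴ)) * (∑ l, (a' l • γ l + b' l • (γ l)ᴴ)))).trace := by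
  rw [trace_mul_oneBody_mul_oneBody_expand ρ₁, trace_mul_oneBody_mul_oneBody_expand ρ₂]
  refine Finset.sum_congr rfl fun k _ => Finset.sum_congr rfl fun l _ => ?_
  have hA := (trace_words_of_annihilate h₁ k l).2.1
  have hA' := (trace_words_of_annihilate h₂ k l).2.1
  have hB := (trace_words_of_annihilate h₁ l k).1
  have hB' := (trace_words_of_annihilate h₂ l k).1
  have hC := (trace_words_of_annihilate h₁ k l).2.2.1
  have hC' := (trace_words_of_annihilate h₂ k l).2.2.1
  rw [hA, hA', hB, hB', hC, hC', trace_mul_mul_eq_of_annihilate h₁ h₂ hanti htr k l]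

/-- **The quasi-free value, explicitly** (CAR data `{γ_k, γ_lᴴ} = δ_{kl}`): in every annihilated state,
`Tr(ρ · AB) = (Σ_k a_k b'_k) · Tr ρ` for `A = Σ_k (a_k γ_k + b_k γ_kᴴ)`, `B = Σ_l (a'_l γ_l + b'_l γ_lᴴ)` — only the
words `γ_kγ_kᴴ` survive. This is the number a KKT relaxation containing the rows of `annihilate_of_rows`
certifies for every one-body word of a quadratic fermion Hamiltonian. [cite: BachLiebSolovej1994, §2] -/
theorem trace_oneBody_mul_oneBody_of_car [Fintype K] [DecidableEq K]
    (hann : ∀ k, γ k * ρ = 0 ∧ ρ * (γ k)ᴴ = 0)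
    (hcar : ∀ k l, γ k * (γ l)ᴴ + (γ l)ᴴ * γ k = if k = l then 1 else 0) (a b a' b' : K → ℂ) :
    (ρ * ((∑ k, (a k • γ k + b k • (γ k)ᴴ)) * (∑ l, (a' l • γ l + b' l • (γ l)ᴴ)))).trace =
      (∑ k, a k * b' k) * ρ.trace := by
  rw [trace_mul_oneBody_mul_oneBody_expand ρ, Finset.sum_mul]
  refine Finset.sum_congr rfl fun k _ => ?_
  have hterm : ∀ l, a k * a' l * (ρ * (γ k * γ l)).trace + a k * b' l * (ρ * (γ k * (γ l)ᴴ)).trace +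
      b k * a' l * (ρ * ((γ k)ᴴ * γ l)).trace + b k * b' l * (ρ * ((γ k)ᴴ * (γ l)ᴴ)).trace =
        if k = l then a k * b' k * ρ.trace else 0 := by
    intro l
    rw [(trace_words_of_annihilate hann k l).2.1, (trace_words_of_annihilate hann l k).1,
      (trace_words_of_annihilate hann k l).2.2.1, trace_mul_mul_conjTranspose_of_car hann hcar k l]
    split_ifs with hkl
    · subst hkl; ring
    · ring
  simp_rw [hterm]
  rw [Finset.sum_ite_eq, if_pos (Finset.mem_univ _)]

end Family

end Literature.MathematicalPhysics.QuantumLattice
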